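/-
Copyright (c) 2026. All rights reserved.
Released under Apache 2.0 license as described in the file LICENSE.
-/
import Summits.AtomisticToContinuum.Crystallization.Theorems.ChartedZeroExcessLayeredLatticeLiouvilleVY

/-!
# ChartedZeroExcessLayeredLatticeLiouville — part VZ «ModeRigidity»: brick (4b) — every `ϱ`-truncated mode is RIGID, `ModeRigidAt C ϱ n₁` with `C(κ₀, c₀)`
  and `n₁(κ₀, c₀)` independent of `ϱ` (decomp-a2c-lens-2, g58; closes brick (4b) MODE RIGIDITY of stmt-AtomisticToContinuum-26636, leaf (LD′) `ModalLipschitzZ`)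

Assembly of VX (increments `‖Δ‖ ≤ K(‖F‖ + A‖g‖₁)`, conserved flux `F`), VY (inner-gap flux bound) and the energy lower bounds:
* VZ.1 `sq_mul_sum_increments_le_idxEnergy` — `(2R+1)²·Σ_{|k − α₀| ≤ R, k < α₀+R} ‖Δ k‖² ≤ idxEnergy M (idxBall x₀ n)` (VE cube chart, VJ template) and
  the mode displacement bound `‖M Y − M X‖ ≤ dist X Y·(‖g‖₁ + D)`;
* VZ.2 `rigid_arith` — the real-arithmetic absorption: with rim depth `s`, `54(196F₀)²K²(s+1)⁻⁴ ≤ ½` (`rim_absorb`) the rim term of VY is absorbed, giving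
  `(2R+1)³(‖g‖₁ + D)² ≤ rigidConst·E`;
* VZ.3 ★★★ `modeRigidAt_of_tail` — `ModeRigidAt (rigidConst c (κ₀ − ε/2)) ϱ (2·rimDepth + 2) a b w` under the tail bound at `ε < 2κ₀`; the statement shape
  `ModeRigidShape` (the `ModeRigidAt` half of `ModalLipschitzZ`, without `IsTameIndexing`) and its witness `modeRigidShape_holds`.
-/

namespace Summit.AtomisticToContinuum.Crystallization.Theorems.ChartedZeroExcessLayeredLatticeLiouville

open Summit.AtomisticToContinuum.Crystallization.Theorems.ChartedPlanarOrderRigidityDoor (E3)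
open Finset
open scoped InnerProductSpace RealInnerProductSpace BigOperators

noncomputable section ModeRigidity

variable {c : ℝ} {a b : E3} {w : ℤ → E3}

/-! ### VZ.1  Energy lower bound by the inner vertical increments; the mode displacement bound -/

/-- ★ VERTICAL ENERGY BOUND at a general centre: `(2R+1)² · Σ_{k<2R} ‖cf (α₀+k−R+1) − cf (α₀+k−R)‖² ≤ idxEnergy (modeField g cf) (idxBall x₀ n)`
(`R = ⌊n⌋₊`, `α₀ = x₀.2`; VE `boxSum_latDiff_le_idxEnergy` along `idxAxis₃` — the slope cancels in vertical differences). [this file, g58] -/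
theorem sq_mul_sum_increments_le_idxEnergy (g : Fin 2 → E3) (cf : ℤ → E3) (x₀ : Cell 2 × ℤ) {n : ℝ} (hn : 0 ≤ n) :
    (((2 * ⌊n⌋₊ + 1 : ℕ)) : ℝ) ^ 2 * ∑ k ∈ range (2 * ⌊n⌋₊), ‖cf (x₀.2 + k - ⌊n⌋₊ + 1) - cf (x₀.2 + k - ⌊n⌋₊)‖ ^ 2 ≤
      idxEnergy (modeField g cf) (idxBall x₀ n) := by
  have hstep : ∀ i ∈ range (2 * ⌊n⌋₊ + 1), ∀ j ∈ range (2 * ⌊n⌋₊ + 1), ∀ k ∈ range (2 * ⌊n⌋₊),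
      cubePt x₀ ⌊n⌋₊ i j k + idxAxis₃ ∈ idxBallF x₀ n := by
    intro i hi j hj k hk
    rw [mem_range] at hi hj hk
    rw [← cubePt_succ₃]
    exact cubePt_mem x₀ hn (by omega) (by omega) (by omega)
  have h := boxSum_latDiff_le_idxEnergy x₀ hn (modeField g cf) (e := idxAxis₃) dist_add_idxAxis₃_le
    (a := range (2 * ⌊n⌋₊ + 1)) (b := range (2 * ⌊n⌋₊ + 1)) (c := range (2 * ⌊n⌋₊)) subset_rfl subset_rfl (range_mono (by omega)) hstep
  refine le_trans (le_of_eq ?_) h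
  have hval : ∀ j ∈ range (2 * ⌊n⌋₊ + 1), ∀ i ∈ range (2 * ⌊n⌋₊ + 1), ∀ k ∈ range (2 * ⌊n⌋₊),
      ‖latDiff idxAxis₃ (modeField g cf) (cubePt x₀ ⌊n⌋₊ i j k).1 (cubePt x₀ ⌊n⌋₊ i j k).2‖ ^ 2 =
        ‖cf (x₀.2 + k - ⌊n⌋₊ + 1) - cf (x₀.2 + k - ⌊n⌋₊)‖ ^ 2 := by
    intro j _ i _ k _
    have h2 : (cubePt x₀ ⌊n⌋₊ i j k).2 = x₀.2 + k - ⌊n⌋₊ := by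
      have := cubePt_sub_snd x₀ ⌊n⌋₊ i j k
      rw [Prod.snd_sub] at this
      omega
    have h3 : (cubePt x₀ ⌊n⌋₊ i j k + idxAxis₃).1 = (cubePt x₀ ⌊n⌋₊ i j k).1 := by simp [idxAxis₃]
    have h4 : (cubePt x₀ ⌊n⌋₊ i j k + idxAxis₃).2 = (cubePt x₀ ⌊n⌋₊ i j k).2 + 1 := by simp [idxAxis₃]
    rw [latDiff_apply, h3, h4, h2]
    simp only [modeField, add_sub_add_left_eq_sub]
  rw [sum_congr rfl fun j hj => sum_congr rfl fun i hi => sum_congr rfl fun k hk => hval j hj i hi k hk]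
  simp only [sum_const, card_range, nsmul_eq_mul]
  push_cast
  ring

/-- LAYER RE-INDEXING `Σ_{k ∈ [α₀−R, α₀+R−1]} f k = Σ_{t<2R} f (α₀ + t − R)`. [formal bookkeeping] -/
theorem sum_Icc_eq_sum_range_shift (f : ℤ → ℝ) (α₀ : ℤ) (R : ℕ) :
    ∑ k ∈ Icc (α₀ - R) (α₀ + R - 1), f k = ∑ t ∈ range (2 * R), f (α₀ + t - R) := by
  have himg : (range (2 * R)).image (fun t : ℕ => α₀ + (t : ℤ) - R) = Icc (α₀ - R) (α₀ + R - 1) := by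
    ext x
    simp only [mem_image, mem_range, mem_Icc]
    constructor
    · rintro ⟨t, ht, rfl⟩
      omega
    · intro hx
      exact ⟨(x - α₀ + R).toNat, by omega, by omega⟩
  rw [← himg, sum_image fun x _ y _ h => by omega]

/-- CHAIN BOUND from bounded increments, forward: `‖cf (α + n) − cf α‖ ≤ n·D`. [formal bookkeeping] -/
theorem norm_sub_le_of_increment_le {cf : ℤ → E3} {D : ℝ} (hD : ∀ k : ℤ, ‖cf (k + 1) - cf k‖ ≤ D) (α : ℤ) (n : ℕ) :
    ‖cf (α + n) - cf α‖ ≤ n * D := by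
  induction n with
  | zero => simp
  | succ n ih =>
    have hsplit : cf (α + ((n + 1 : ℕ) : ℤ)) - cf α = (cf (α + n + 1) - cf (α + n)) + (cf (α + n) - cf α) := by
      push_cast
      rw [← add_assoc, sub_add_sub_cancel]
    rw [hsplit]
    refine (norm_add_le _ _).trans ?_
    have h1 := hD (α + n)
    push_cast
    linarith

/-- CHAIN BOUND from bounded increments: `‖cf β − cf α‖ ≤ D·|β − α|`. [formal bookkeeping] -/
theorem chain_le_of_increment_le {cf : ℤ → E3} {D : ℝ} (hD : ∀ k : ℤ, ‖cf (k + 1) - cf k‖ ≤ D) (α β : ℤ) :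
    ‖cf β - cf α‖ ≤ D * |(((β - α : ℤ)) : ℝ)| := by
  rcases le_total α β with h | h
  · obtain ⟨n, rfl⟩ : ∃ n : ℕ, β = α + n := ⟨(β - α).toNat, by omega⟩
    have h1 := norm_sub_le_of_increment_le hD α n
    have h2 : |(((α + n - α : ℤ)) : ℝ)| = n := by
      push_cast
      rw [add_sub_cancel_left, abs_of_nonneg (Nat.cast_nonneg n)]
    rw [h2, mul_comm]
    exact h1
  · obtain ⟨n, rfl⟩ : ∃ n : ℕ, α = β + n := ⟨(α - β).toNat, by omega⟩
    have h1 := norm_sub_le_of_increment_le hD β n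
    have h2 : |(((β - (β + n) : ℤ)) : ℝ)| = n := by
      push_cast
      rw [sub_add_cancel_left, abs_neg, abs_of_nonneg (Nat.cast_nonneg n)]
    rw [h2, mul_comm, norm_sub_rev]
    exact h1

/-- MODE DISPLACEMENT BOUND: `‖M Y − M X‖ ≤ dist X Y·(‖g 0‖ + ‖g 1‖ + D)` for a mode field with increments bounded by `D` (VH `affine_sub_eq'`).
[formal bookkeeping] -/
theorem norm_modeField_sub_le (g : Fin 2 → E3) (cf : ℤ → E3) {D : ℝ} (hD : ∀ k : ℤ, ‖cf (k + 1) - cf k‖ ≤ D) (X Y : Cell 2 × ℤ) :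
    ‖modeField g cf Y.1 Y.2 - modeField g cf X.1 X.2‖ ≤ dist X Y * (‖g 0‖ + ‖g 1‖ + D) := by
  have hD0 : 0 ≤ D := (norm_nonneg _).trans (hD 0)
  have hMform : ∀ (γ : Cell 2) (α : ℤ), modeField g cf γ α = (∑ j, ((γ j : ℤ) : ℝ) • g j) + cf α := fun _ _ => rfl
  rw [affine_sub_eq' hMform X Y, Fin.sum_univ_two]
  have hd : ∀ j : Fin 2, |(((Y.1 j - X.1 j : ℤ)) : ℝ)| ≤ dist X Y := fun j => by
    rw [dist_eq_idxNorm, ← Int.cast_abs, ← Nat.cast_natAbs]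
    have := natAbs_fst_le_idxNorm (Y - X) j
    exact_mod_cast this
  have hd2 : |(((Y.2 - X.2 : ℤ)) : ℝ)| ≤ dist X Y := by
    rw [dist_eq_idxNorm, ← Int.cast_abs, ← Nat.cast_natAbs]
    have := natAbs_snd_le_idxNorm (Y - X)
    exact_mod_cast this
  have h0 : ‖(((Y.1 0 - X.1 0 : ℤ)) : ℝ) • g 0‖ ≤ dist X Y * ‖g 0‖ := by
    rw [norm_smul, Real.norm_eq_abs]
    exact mul_le_mul_of_nonneg_right (hd 0) (norm_nonneg _)
  have h1 : ‖(((Y.1 1 - X.1 1 : ℤ)) : ℝ) • g 1‖ ≤ dist X Y * ‖g 1‖ := by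
    rw [norm_smul, Real.norm_eq_abs]
    exact mul_le_mul_of_nonneg_right (hd 1) (norm_nonneg _)
  have h2 : ‖cf Y.2 - cf X.2‖ ≤ dist X Y * D := by
    refine (chain_le_of_increment_le hD X.2 Y.2).trans ?_
    rw [mul_comm]
    exact mul_le_mul_of_nonneg_right hd2 hD0
  calc ‖(((Y.1 0 - X.1 0 : ℤ)) : ℝ) • g 0 + (((Y.1 1 - X.1 1 : ℤ)) : ℝ) • g 1 + (cf Y.2 - cf X.2)‖
      ≤ ‖(((Y.1 0 - X.1 0 : ℤ)) : ℝ) • g 0 + (((Y.1 1 - X.1 1 : ℤ)) : ℝ) • g 1‖ + ‖cf Y.2 - cf X.2‖ := norm_add_le _ _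
    _ ≤ ‖(((Y.1 0 - X.1 0 : ℤ)) : ℝ) • g 0‖ + ‖(((Y.1 1 - X.1 1 : ℤ)) : ℝ) • g 1‖ + ‖cf Y.2 - cf X.2‖ := by
        gcongr
        exact norm_add_le _ _
    _ ≤ dist X Y * ‖g 0‖ + dist X Y * ‖g 1‖ + dist X Y * D := by linarith
    _ = dist X Y * (‖g 0‖ + ‖g 1‖ + D) := by ring

/-! ### VZ.2  The constants and the real-arithmetic absorption -/

/-- RIM DEPTH `s(c, δ) = ⌈108·(196·kernelConst c·modeConst c δ)²⌉₊`: beyond this distance from the rim the flux-block tails are absorbable. [this file, g58] -/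
def rimDepth (c δ : ℝ) : ℕ := ⌈108 * (196 * kernelConst c * modeConst c δ) ^ 2⌉₊

/-- the MODE RIGIDITY CONSTANT `12 + 248 (K·441F₀)² + 432 (196F₀·K)²` (`F₀ = kernelConst c`, `K = modeConst c δ`). [this file, g58] -/
def rigidConst (c δ : ℝ) : ℝ := 12 + 248 * (modeConst c δ * (441 * kernelConst c)) ^ 2 + 432 * (196 * kernelConst c * modeConst c δ) ^ 2

/-- `12 ≤ rigidConst`. [formal bookkeeping] -/
theorem twelve_le_rigidConst (c δ : ℝ) : 12 ≤ rigidConst c δ := by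
  unfold rigidConst
  have h1 : 0 ≤ 248 * (modeConst c δ * (441 * kernelConst c)) ^ 2 := by positivity
  have h2 : 0 ≤ 432 * (196 * kernelConst c * modeConst c δ) ^ 2 := by positivity
  linarith

/-- RIM ABSORPTION: `54·(196F₀)²·K²·((s+1)⁻²)² ≤ ½` for `s = rimDepth c δ`. [formal bookkeeping] -/
theorem rim_absorb (c δ : ℝ) :
    54 * (196 * kernelConst c) ^ 2 * modeConst c δ ^ 2 * (((((rimDepth c δ : ℕ) : ℝ) + 1)⁻¹) ^ 2) ^ 2 ≤ 1 / 2 := by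
  set L : ℝ := 108 * (196 * kernelConst c * modeConst c δ) ^ 2 with hL
  have hL0 : 0 ≤ L := by positivity
  have hs : L ≤ ((rimDepth c δ : ℕ) : ℝ) + 1 := (Nat.le_ceil L).trans (by simp [rimDepth, hL])
  have hpos : (0 : ℝ) < ((rimDepth c δ : ℕ) : ℝ) + 1 := by positivity
  set τ : ℝ := (((rimDepth c δ : ℕ) : ℝ) + 1)⁻¹ with hτ
  have hτ0 : 0 ≤ τ := by positivity
  have hτ1 : τ ≤ 1 := inv_le_one_of_one_le₀ (by linarith [show (0 : ℝ) ≤ ((rimDepth c δ : ℕ) : ℝ) from Nat.cast_nonneg _])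
  have hLτ : L * τ ≤ 1 := by
    calc L * τ ≤ (((rimDepth c δ : ℕ) : ℝ) + 1) * τ := mul_le_mul_of_nonneg_right hs hτ0
      _ = 1 := mul_inv_cancel₀ hpos.ne'
  have hτ4 : (τ ^ 2) ^ 2 ≤ τ := by
    have : (τ ^ 2) ^ 2 = τ ^ 4 := by ring
    rw [this]
    calc τ ^ 4 ≤ τ ^ 1 := pow_le_pow_of_le_one hτ0 hτ1 (by norm_num)
      _ = τ := pow_one τ
  have hid : 54 * (196 * kernelConst c) ^ 2 * modeConst c δ ^ 2 = L / 2 := by rw [hL]; ring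
  rw [hid]
  calc L / 2 * (τ ^ 2) ^ 2 ≤ L / 2 * τ := mul_le_mul_of_nonneg_left hτ4 (by positivity)
    _ = L * τ / 2 := by ring
    _ ≤ 1 / 2 := by linarith

/-- ★ THE ABSORPTION ARITHMETIC: with `P = 2R+1`, `Q = 2R'` (`P ≤ 2Q`, `Q ≤ P − 1`, `P ≥ 3`), increments `D = K(Fn + AG)`, VY's inner-gap bound (`ha`), the
vertical (`hb`) and in-plane (`hc`) energy bounds and the rim absorption `54(196F₀)²K²τ² ≤ ½`: `P³(G + D)² ≤ (12 + 248(KA)² + 432(196F₀K)²)·E`.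
[this file, g58] -/
theorem rigid_arith {P Q Fn G V E F₀ K A τ D : ℝ} (hP : 3 ≤ P) (hQP : P ≤ 2 * Q) (hQP' : Q ≤ P - 1)
    (hστ : 54 * (196 * F₀) ^ 2 * K ^ 2 * τ ^ 2 ≤ 1 / 2) (hD : D = K * (Fn + A * G))
    (ha : Q * Fn ^ 2 ≤ 27 * (196 * F₀) ^ 2 * V + Q * (3 * (196 * F₀ * D * (3 * τ)) ^ 2 + 3 * (A * G) ^ 2))
    (hb : P ^ 2 * V ≤ E) (hc : (P - 1) * P ^ 2 * G ^ 2 ≤ 4 * E) :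
    P ^ 3 * (G + D) ^ 2 ≤ (12 + 248 * (K * A) ^ 2 + 432 * (196 * F₀ * K) ^ 2) * E := by
  have hQ0 : 0 ≤ Q := by linarith
  have hP0 : 0 ≤ P := by linarith
  subst hD
  have hsq : (Fn + A * G) ^ 2 ≤ 2 * (Fn ^ 2 + (A * G) ^ 2) := by nlinarith [sq_nonneg (Fn - A * G)]
  have hD2 : (K * (Fn + A * G)) ^ 2 ≤ 2 * K ^ 2 * (Fn ^ 2 + (A * G) ^ 2) := by
    rw [mul_pow]
    calc K ^ 2 * (Fn + A * G) ^ 2 ≤ K ^ 2 * (2 * (Fn ^ 2 + (A * G) ^ 2)) := mul_le_mul_of_nonneg_left hsq (sq_nonneg K)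
      _ = 2 * K ^ 2 * (Fn ^ 2 + (A * G) ^ 2) := by ring
  -- Step A: the rim term is absorbed
  have hA1 : Q * (3 * (196 * F₀ * (K * (Fn + A * G)) * (3 * τ)) ^ 2) ≤ Q * ((Fn ^ 2 + (A * G) ^ 2) / 2) := by
    refine mul_le_mul_of_nonneg_left ?_ hQ0
    have hrim : 3 * (196 * F₀ * (K * (Fn + A * G)) * (3 * τ)) ^ 2 = 27 * (196 * F₀) ^ 2 * τ ^ 2 * (K * (Fn + A * G)) ^ 2 := by ring
    rw [hrim]
    calc 27 * (196 * F₀) ^ 2 * τ ^ 2 * (K * (Fn + A * G)) ^ 2 ≤ 27 * (196 * F₀) ^ 2 * τ ^ 2 * (2 * K ^ 2 * (Fn ^ 2 + (A * G) ^ 2)) :=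
          mul_le_mul_of_nonneg_left hD2 (by positivity)
      _ = 54 * (196 * F₀) ^ 2 * K ^ 2 * τ ^ 2 * (Fn ^ 2 + (A * G) ^ 2) := by ring
      _ ≤ 1 / 2 * (Fn ^ 2 + (A * G) ^ 2) := mul_le_mul_of_nonneg_right hστ (by positivity)
      _ = (Fn ^ 2 + (A * G) ^ 2) / 2 := by ring
  -- Step B: the inner-gap bound after absorption
  have ha' : Q * Fn ^ 2 ≤ 27 * (196 * F₀) ^ 2 * V + Q * (3 * (196 * F₀ * (K * (Fn + A * G)) * (3 * τ)) ^ 2) + 3 * (Q * (A * G) ^ 2) := by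
    have hid : Q * (3 * (196 * F₀ * (K * (Fn + A * G)) * (3 * τ)) ^ 2 + 3 * (A * G) ^ 2) =
        Q * (3 * (196 * F₀ * (K * (Fn + A * G)) * (3 * τ)) ^ 2) + 3 * (Q * (A * G) ^ 2) := by ring
    linarith
  have hid2 : Q * ((Fn ^ 2 + (A * G) ^ 2) / 2) = (Q * Fn ^ 2) / 2 + (Q * (A * G) ^ 2) / 2 := by ring
  have hB : Q * Fn ^ 2 ≤ 54 * (196 * F₀) ^ 2 * V + 7 * (Q * (A * G) ^ 2) := by linarith
  -- Step C: the flux share of the displacement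
  have hC1 : P ^ 3 * Fn ^ 2 ≤ 2 * P ^ 2 * (Q * Fn ^ 2) := by
    have h1 : P ^ 3 * Fn ^ 2 = P * (P ^ 2 * Fn ^ 2) := by ring
    have h2 : 2 * P ^ 2 * (Q * Fn ^ 2) = (2 * Q) * (P ^ 2 * Fn ^ 2) := by ring
    rw [h1, h2]
    exact mul_le_mul_of_nonneg_right hQP (by positivity)
  have hC2 : 2 * P ^ 2 * (Q * Fn ^ 2) ≤ 108 * (196 * F₀) ^ 2 * (P ^ 2 * V) + 14 * A ^ 2 * (Q * P ^ 2 * G ^ 2) := by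
    calc 2 * P ^ 2 * (Q * Fn ^ 2) ≤ 2 * P ^ 2 * (54 * (196 * F₀) ^ 2 * V + 7 * (Q * (A * G) ^ 2)) := mul_le_mul_of_nonneg_left hB (by positivity)
      _ = 108 * (196 * F₀) ^ 2 * (P ^ 2 * V) + 14 * A ^ 2 * (Q * P ^ 2 * G ^ 2) := by ring
  have hC3 : Q * P ^ 2 * G ^ 2 ≤ 4 * E := by
    have h1 : Q * P ^ 2 * G ^ 2 ≤ (P - 1) * P ^ 2 * G ^ 2 := by
      have : Q * P ^ 2 * G ^ 2 = Q * (P ^ 2 * G ^ 2) := by ring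
      have h' : (P - 1) * P ^ 2 * G ^ 2 = (P - 1) * (P ^ 2 * G ^ 2) := by ring
      rw [this, h']
      exact mul_le_mul_of_nonneg_right hQP' (by positivity)
    exact h1.trans hc
  have hC4 := mul_le_mul_of_nonneg_left hb (by positivity : (0 : ℝ) ≤ 108 * (196 * F₀) ^ 2)
  have hC5 := mul_le_mul_of_nonneg_left hC3 (by positivity : (0 : ℝ) ≤ 14 * A ^ 2)
  have hC : P ^ 3 * Fn ^ 2 ≤ (108 * (196 * F₀) ^ 2 + 56 * A ^ 2) * E := by linarith
  -- Step D: the in-plane share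
  have hDst : P ^ 3 * G ^ 2 ≤ 6 * E := by
    have h1 : P ≤ 3 / 2 * (P - 1) := by linarith
    have h2 : P ^ 3 * G ^ 2 = P * (P ^ 2 * G ^ 2) := by ring
    have h3 : P * (P ^ 2 * G ^ 2) ≤ 3 / 2 * (P - 1) * (P ^ 2 * G ^ 2) := mul_le_mul_of_nonneg_right h1 (by positivity)
    have h4 : 3 / 2 * (P - 1) * (P ^ 2 * G ^ 2) = 3 / 2 * ((P - 1) * P ^ 2 * G ^ 2) := by ring
    linarith
  -- Step E: the displacement
  have hE1 : (G + K * (Fn + A * G)) ^ 2 ≤ (2 + 4 * (K * A) ^ 2) * G ^ 2 + 4 * K ^ 2 * Fn ^ 2 := by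
    nlinarith [sq_nonneg (G - K * (Fn + A * G)), sq_nonneg (K * Fn - K * A * G)]
  calc P ^ 3 * (G + K * (Fn + A * G)) ^ 2 ≤ P ^ 3 * ((2 + 4 * (K * A) ^ 2) * G ^ 2 + 4 * K ^ 2 * Fn ^ 2) :=
        mul_le_mul_of_nonneg_left hE1 (by positivity)
    _ = (2 + 4 * (K * A) ^ 2) * (P ^ 3 * G ^ 2) + 4 * K ^ 2 * (P ^ 3 * Fn ^ 2) := by ring
    _ ≤ (2 + 4 * (K * A) ^ 2) * (6 * E) + 4 * K ^ 2 * ((108 * (196 * F₀) ^ 2 + 56 * A ^ 2) * E) :=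
        add_le_add (mul_le_mul_of_nonneg_left hDst (by positivity)) (mul_le_mul_of_nonneg_left hC (by positivity))
    _ = (12 + 248 * (K * A) ^ 2 + 432 * (196 * F₀ * K) ^ 2) * E := by ring

/-! ### VZ.3  ★★★ Mode rigidity -/

/-- ★★ THE CORE ESTIMATE: for a `ϱ`-truncated mode `M`, a centre `x₀` and `n ≥ 2·rimDepth + 2`,
`‖M Y − M X‖²·#(idxBall x₀ n) ≤ rigidConst·dist X Y²·idxEnergy M (idxBall x₀ n)`. [this file, g58] -/
theorem modeRigid_core (hc : 0 < c) (hL : IsLayeredCrystal c a b w) {κ₀ ε ϱ : ℝ} (hϱ : 0 ≤ ϱ) (hε : ε < 2 * κ₀)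
    (hK : CoerciveZ (layeredKernel a b w) κ₀)
    (hT : ∀ φ : Cell 2 → ℤ → E3, HasFiniteSupport φ → Summable (tailFam ϱ a b w φ) ∧ ∑' x, tailFam ϱ a b w φ x ≤ ε * nnFormZ φ)
    {M : Cell 2 → ℤ → E3} (hM : IsTruncMode ϱ a b w M) (x₀ : Cell 2 × ℤ) {n : ℝ} (hn : (((2 * rimDepth c (κ₀ - ε / 2) + 2 : ℕ)) : ℝ) ≤ n)
    (X Y : Cell 2 × ℤ) :
    ‖M Y.1 Y.2 - M X.1 X.2‖ ^ 2 * ((idxBall x₀ n).ncard : ℝ) ≤ rigidConst c (κ₀ - ε / 2) * dist X Y ^ 2 * idxEnergy M (idxBall x₀ n) := by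
  have hδ : 0 < κ₀ - ε / 2 := by linarith
  obtain ⟨g, cf, rfl, hcol, hinc⟩ := truncMode_increment_le hc hL hϱ hε hK hT hM
  have hn0 : 0 ≤ n := le_trans (Nat.cast_nonneg _) hn
  -- the radii
  set s : ℕ := rimDepth c (κ₀ - ε / 2) with hs
  set R : ℕ := ⌊n⌋₊ with hR
  have hsR : 2 * s + 2 ≤ R := Nat.le_floor hn
  have hRs : R - (R - s) = s := by omega
  -- the increments bound `D`
  set D : ℝ := modeConst c (κ₀ - ε / 2) * (‖columnFlux ϱ a b w ⌊ϱ / c⌋₊ g cf 0‖ + 441 * kernelConst c * (‖g 0‖ + ‖g 1‖)) with hDdef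
  have hD : ∀ k : ℤ, ‖cf (k + 1) - cf k‖ ≤ D := hinc
  -- (a) the inner-gap flux bound with conserved flux
  have ha := flux_sq_sum_le hc hL ϱ g cf hD x₀.2 R (R - s)
  rw [hRs, sum_congr rfl fun m _ => by rw [hcol m], sum_const, nsmul_eq_mul, Int.card_Icc] at ha
  have hcard : (((x₀.2 + ((R - s : ℕ) : ℤ) - 1 + 1 - (x₀.2 - ((R - s : ℕ) : ℤ))).toNat : ℕ) : ℝ) = ((2 * (R - s) : ℕ) : ℝ) := by
    have h : (x₀.2 + ((R - s : ℕ) : ℤ) - 1 + 1 - (x₀.2 - ((R - s : ℕ) : ℤ))).toNat = 2 * (R - s) := by omega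
    rw [h]
  rw [hcard] at ha
  -- (b) the vertical energy bound, re-indexed
  have hb := sq_mul_sum_increments_le_idxEnergy g cf x₀ hn0
  rw [← hR, ← sum_Icc_eq_sum_range_shift (fun k => ‖cf (k + 1) - cf k‖ ^ 2) x₀.2 R] at hb
  push_cast at hb
  -- (c) the in-plane energy bounds
  have hg0 := box_mul_sq_le_idxEnergy₁ (M := modeField g cf) (g := g) (c := cf) (fun _ _ => rfl) x₀ hn0
  have hg1 := box_mul_sq_le_idxEnergy₂ (M := modeField g cf) (g := g) (c := cf) (fun _ _ => rfl) x₀ hn0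
  rw [← hR] at hg0 hg1
  push_cast at hg0 hg1
  have hGsq : (‖g 0‖ + ‖g 1‖) ^ 2 ≤ 2 * ‖g 0‖ ^ 2 + 2 * ‖g 1‖ ^ 2 := by nlinarith [sq_nonneg (‖g 0‖ - ‖g 1‖)]
  have hc' : (2 * (R : ℝ) + 1 - 1) * (2 * (R : ℝ) + 1) ^ 2 * (‖g 0‖ + ‖g 1‖) ^ 2 ≤ 4 * idxEnergy (modeField g cf) (idxBall x₀ n) := by
    have h1 := mul_le_mul_of_nonneg_left hGsq (by positivity : (0 : ℝ) ≤ 2 * (R : ℝ) * (2 * (R : ℝ) + 1) ^ 2)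
    have h2 : (2 * (R : ℝ) + 1 - 1) * (2 * (R : ℝ) + 1) ^ 2 * (‖g 0‖ + ‖g 1‖) ^ 2 = 2 * (R : ℝ) * (2 * (R : ℝ) + 1) ^ 2 * (‖g 0‖ + ‖g 1‖) ^ 2 := by
      ring
    rw [h2]
    nlinarith [h1, hg0, hg1]
  -- the count of the ball and the displacement
  have hN : ((idxBall x₀ n).ncard : ℝ) = (2 * (R : ℝ) + 1) ^ 3 := by
    rw [← coe_idxBallF, Set.ncard_coe_finset, card_idxBallF_eq x₀ hn0, ← hR]
    push_cast
    ring
  have hdisp := norm_modeField_sub_le g cf hD X Y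
  have hdisp2 : ‖modeField g cf Y.1 Y.2 - modeField g cf X.1 X.2‖ ^ 2 ≤ (dist X Y * (‖g 0‖ + ‖g 1‖ + D)) ^ 2 :=
    pow_le_pow_left₀ (norm_nonneg _) hdisp 2
  -- the arithmetic
  have hP : (3 : ℝ) ≤ 2 * (R : ℝ) + 1 := by
    have : (1 : ℝ) ≤ (R : ℝ) := by exact_mod_cast (show 1 ≤ R by omega)
    linarith
  have hQP : 2 * (R : ℝ) + 1 ≤ 2 * ((2 * (R - s) : ℕ) : ℝ) := by
    have h : 2 * R + 1 ≤ 2 * (2 * (R - s)) := by omega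
    exact_mod_cast h
  have hQP' : ((2 * (R - s) : ℕ) : ℝ) ≤ 2 * (R : ℝ) + 1 - 1 := by
    have h : 2 * (R - s) ≤ 2 * R := by omega
    have h' : ((2 * (R - s) : ℕ) : ℝ) ≤ ((2 * R : ℕ) : ℝ) := by exact_mod_cast h
    push_cast at h' ⊢
    linarith
  have harith := rigid_arith (E := idxEnergy (modeField g cf) (idxBall x₀ n)) hP hQP hQP' (rim_absorb c (κ₀ - ε / 2)) hDdef ha hb hc'
  rw [hN]
  calc ‖modeField g cf Y.1 Y.2 - modeField g cf X.1 X.2‖ ^ 2 * (2 * (R : ℝ) + 1) ^ 3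
      ≤ (dist X Y * (‖g 0‖ + ‖g 1‖ + D)) ^ 2 * (2 * (R : ℝ) + 1) ^ 3 := mul_le_mul_of_nonneg_right hdisp2 (by positivity)
    _ = dist X Y ^ 2 * ((2 * (R : ℝ) + 1) ^ 3 * (‖g 0‖ + ‖g 1‖ + D) ^ 2) := by ring
    _ ≤ dist X Y ^ 2 * ((12 + 248 * (modeConst c (κ₀ - ε / 2) * (441 * kernelConst c)) ^ 2 + 432 * (196 * kernelConst c * modeConst c (κ₀ - ε / 2)) ^ 2) *
          idxEnergy (modeField g cf) (idxBall x₀ n)) := mul_le_mul_of_nonneg_left harith (sq_nonneg _)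
    _ = rigidConst c (κ₀ - ε / 2) * dist X Y ^ 2 * idxEnergy (modeField g cf) (idxBall x₀ n) := by
        unfold rigidConst
        ring

/-- ★★★ (4b) MODE RIGIDITY under the tail bound at `ε < 2κ₀`: `ModeRigidAt (rigidConst c (κ₀ − ε/2)) ϱ (2·rimDepth + 2) a b w` — the constant and the
threshold radius do NOT depend on `ϱ`. [this file, g58] -/
theorem modeRigidAt_of_tail (hc : 0 < c) (hL : IsLayeredCrystal c a b w) {κ₀ ε ϱ : ℝ} (hϱ : 0 ≤ ϱ) (hε : ε < 2 * κ₀)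
    (hK : CoerciveZ (layeredKernel a b w) κ₀)
    (hT : ∀ φ : Cell 2 → ℤ → E3, HasFiniteSupport φ → Summable (tailFam ϱ a b w φ) ∧ ∑' x, tailFam ϱ a b w φ x ≤ ε * nnFormZ φ) :
    ModeRigidAt (rigidConst c (κ₀ - ε / 2)) ϱ (((2 * rimDepth c (κ₀ - ε / 2) + 2 : ℕ)) : ℝ) a b w :=
  fun _ hM x₀ _ hn X Y => modeRigid_core hc hL hϱ hε hK hT hM x₀ hn X Y

/-- (4b) MODE RIGIDITY — the statement shape (g58; the `ModeRigidAt` half of the leaf `ModalLipschitzZ`, WITHOUT the tameness hypothesis): for every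
certified laminate, every range `ϱ ≥ ϱ₁(κ₀, c₀)` and radii `n ≥ n₁(κ₀, c₀)`, every `ϱ`-truncated mode is rigid with a constant `C(κ₀, c₀)`
independent of `ϱ`. [this file, g58] -/
def ModeRigidShape : Prop :=
  TailDominationCert → ∀ κ₀ > (0 : ℝ), ∀ c₀ > (0 : ℝ), ∃ C ≥ (1 : ℝ), ∃ ϱ₁ ≥ (1 : ℝ), ∀ ϱ ≥ ϱ₁, ∃ n₁ > (0 : ℝ), ∀ (a b : E3) (w : ℤ → E3),
    IsLayeredCrystal c₀ a b w → CoerciveZ (layeredKernel a b w) κ₀ → ModeRigidAt C ϱ n₁ a b w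

/-- ★★★ (4b) MODE RIGIDITY HOLDS, with `C = rigidConst c₀ (κ₀/2)`, `ϱ₁ = max 1 ϱ₀(c₀, κ₀)` (tail certificate at `ε = κ₀`) and `n₁ = 2·rimDepth c₀ (κ₀/2) + 2`.
[this file, g58] -/
theorem modeRigidShape_holds : ModeRigidShape := by
  intro hTD κ₀ hκ₀ c₀ hc₀
  obtain ⟨ϱ₀, _, hTail⟩ := hTD c₀ hc₀ κ₀ hκ₀
  refine ⟨rigidConst c₀ (κ₀ - κ₀ / 2), by linarith [twelve_le_rigidConst c₀ (κ₀ - κ₀ / 2)], max 1 ϱ₀, le_max_left _ _, ?_⟩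
  intro ϱ hϱ
  refine ⟨(((2 * rimDepth c₀ (κ₀ - κ₀ / 2) + 2 : ℕ)) : ℝ), by positivity, ?_⟩
  intro a b w hL hK
  have hϱ0 : 0 ≤ ϱ := zero_le_one.trans ((le_max_left _ _).trans hϱ)
  have hϱ₀ϱ : ϱ₀ ≤ ϱ := (le_max_right _ _).trans hϱ
  have hε : κ₀ < 2 * κ₀ := by linarith
  have hT : ∀ φ : Cell 2 → ℤ → E3, HasFiniteSupport φ →
      Summable (tailFam ϱ a b w φ) ∧ ∑' x, tailFam ϱ a b w φ x ≤ κ₀ * nnFormZ φ :=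
    fun φ hφ => hTail ϱ hϱ₀ϱ a b w hL φ hφ
  exact modeRigidAt_of_tail hc₀ hL hϱ0 hε hK hT

end ModeRigidity

end Summit.AtomisticToContinuum.Crystallization.Theorems.ChartedZeroExcessLayeredLatticeLiouville
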